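import Summits.Schanuel.Schanuel.Theorems.RootDecomp1KOddEmpty02

/-!
# RootDecomp1KOddEmpty — lens 1, generation 60, NODE 21 «ODD-PRIME EMPTINESS ON THE K-LINE» (reduction of the whole curve modulo an odd prime ℓ: no affine 𝔽_ℓ-point and no liftable point over Y = ∞ ⇒ no rational point with ℓ-integral abscissa ⇒ every level empty; RULE K-R51 (iii) payable clause; CLAIM L2795, PRICE L2798, K-R52) — continuation (RootDecomp1KOddEmpty03): §5 the families VW / V j (TangentEmptyAt 5), EAW / EA j (OddEmptyAt 3), the refused W4P / VW(−9) / R5P / CJ 0 (section Families)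

(lens-1 g60 NODE 21 HOME kernel K = HOME/decomp-schanuel-lens-1/g60/OddEmpty.lean 5b3adebb…, 1208 l, imports tree …RootDecomp1KCubicDescent05 ONLY = the port of node 20 (no Literature import, no fact def, no private, no set_option, no structure; `decide` only on finite ZMod ℓ checks); Probe / Ctrl0 / Ctrl + NODE-g60.md + SHA256SUMS; CLAIM L2795, census LIVENESS-v16 L2796 (key oddempty; of record L2798), crit g10 EX-ANTE PRICE L2798 (ONE THEOREM ×1 for (A) the general engine OddEmptyAt + (B) the W4-shape engine TangentEmptyAt + (C) the infinite K-R51-territory family V j JOINTLY iff CHECKLIST K-g60 (1)–(11); RULE K-R52 pre-announced), writer g31 NOTE 1 L2799 (pre-kernel arithmetic re-verified), NODE L2801 / REQUEST L2802, critic VERDICT L2804 (crit g10): CLEARED — THEOREM ×1 for (A) the general engine OddEmptyAt + (B) the W4-shape engine TangentEmptyAt + (C) the infinite K-R51-territory family V j JOINTLY under RULE K-R51 (iii), CHECKLIST K-g60 (1)–(11) met 11/11, rung 0; LABEL OF RECORD: literature = KNOWN TOOL (local insolubility at a finite place / reduction mod ℓ restricted to S-integral points, Hensel failure at a double point with anisotropic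 tangent cone) · relative to the record = NEW LEVER (first odd-place reading of the curve on the K-line) with NEW REACH (first K-R51-territory pairs — no ℚ-rational descent datum — decided hypothesis-free, at the currency LevelFinite / every level EMPTY); RULE K-R52 FIXED verbatim as pre-announced L2798 (toolkit ∪= LOCAL SIEVING IN GENERAL — every further OddEmptyAt / TangentEmptyAt member, ℓ, cone, jet, residue-class or Brauer–Manin-type variant ×0-as-record; OPEN TERRITORY at m₀ = 2 := K-R51 territory ∧ LOCALLY LIVE (census key locsol); standing witness W4 with its smooth ℤ[1/2]-point (0, −2)); TALLY lens-1 ×18 + THEOREM ×20; PORT GO exactly as census STAGING NOTES 11/11b L2800/L2803. Port by census-1 gen 23 as `RootDecomp1KOddEmpty01–05` (`--supports stmt-Schanuel-33364`; no census credit): 01 = §0 helpers, §1 the tree's binary forms `hf` at a prime dividing den r, §2 the equation of a rational point in integers for every `xPolyP k c` and the level abscissa (`not_dvd_den_level`), §3 THE GENERAL ENGINE `OddEmptyAt ℓ P` ⇒ `ratPoint_free_of_oddEmptyAt` / `no_level_of_oddEmptyAt` / `levelFinite_of_oddEmptyAt` / `bddLevelEmpty_of_oddEmptyAt` / `thinFibreAt_of_oddEmptyAt`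 (every m₀); 02 = §4 THE W4-SHAPE ENGINE (`descent_step`, `tangent_descent` — the v_ℓ-descent at the double point (0, ∞) with anisotropic tangent form —, `TangentEmptyAt ℓ P` ⇒ `no_level_of_tangentEmptyAt` / `levelFinite_…` / `bddLevelEmpty_…` / `thinFibreAt_of_tangentEmptyAt`) and §4b the REFUSALS (a rational ℓ-integral point / a root at x = 0 / degree conditions / ℓ = 2 kill the hypotheses); 03 = §5 section Families: `VW l` / `V j := VW (−3 + 15j)` with `tangentEmptyAt_five_V`, **`no_level_V`**, **`levelFinite_V`**, `bddLevelEmpty_V`, **`thinFibreAt_V (j m₀)`** HYPOTHESIS-FREE for every m₀, `EAW l` / `EA j` with `oddEmptyAt_three_EA`, `no_level_EA`, `levelFinite_EA`, `thinFibreAt_EA`, the REFUSED members `W4P` (rational point (0, −2)), `VW (−9)`, `R5P`, CJ 0 — typed non-instances; 04 = §6 section Disc: `xDisc (VW l) = vD l` primitive and ℚ-IRREDUCIBLE for l = 3s by a RABIN certificate mod 3 using the TREE's `dvd_X_pow_sub_X_zmod3` / `irreducible_of_coprime_zmod3` / `irreducible_of_irreducible_map3` (node 20); 05 = §7 section Territory: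 `V_territory (j)` (the K-R49 conjunction by tree names ∧ the K-R51 k = 2 certificate `Irreducible ((xDisc (V j)).map ℚ)`, degree 6 ≡ 2 mod 4 ∧ LevelFinite ∧ ∀ m₀ ThinFibreAt), `V_injective`, named members V0 / V1. PORT EDITS: NONE beyond the provenance doc blocks and the continuation headers (no docstring added — K documents every declaration —, no privatisation — the head dry-run showed no dedup code —, no re-pointing, no import change, no set_option; K's `@[simp]` kept); provenance doc blocks + continuation headers = K's own open-lines; statements and proofs VERBATIM. Rung 0 — nothing here proves Schanuel, 33364, 33363, 31077 or ThinFibre 2; everything HYPOTHESIS-FREE.)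
-/

noncomputable section

namespace Summit.Schanuel.Schanuel.Theorems.RootDecomp1KOddEmpty

open Polynomial LiouvilleNumber
open scoped Nat
open Summit.Schanuel.Schanuel.Theorems.RootDecomp1KTwoBaseCell (psNumer partialSum_eq_psNumer_div coprime_psNumer)
open Summit.Schanuel.Schanuel.Theorems.RootDecomp1KDegreeLadder
open Summit.Schanuel.Schanuel.Theorems.RootDecomp1KXLinear
open Summit.Schanuel.Schanuel.Theorems.RootDecomp1KXLinearII
open Summit.Schanuel.Schanuel.Theorems.RootDecomp1KXTop
open Summit.Schanuel.Schanuel.Theorems.RootDecomp1KXAll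
open Summit.Schanuel.Schanuel.Theorems.RootDecomp1KLevelFinite
open Summit.Schanuel.Schanuel.Theorems.RootDecomp1KThueMahler
open Summit.Schanuel.Schanuel.Theorems.RootDecomp1KParamThueMahler
open Summit.Schanuel.Schanuel.Theorems.RootDecomp1KLocalExponent
open Summit.Schanuel.Schanuel.Theorems.RootDecomp1KIntegrality (GaussAt gaussAt_xPolyP_iff level_identity_rat)
open Summit.Schanuel.Schanuel.Theorems.RootDecomp1KSubspaceBranch (SepTopAt)
open Summit.Schanuel.Schanuel.Theorems.RootDecomp1KHeightGrading (BddLevelEmpty bddLevelEmpty_iff_levelFinite)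
open Summit.Schanuel.Schanuel.Theorems.RootDecomp1KRunge
open Summit.Schanuel.Schanuel.Theorems.RootDecomp1KDescent
open Summit.Schanuel.Schanuel.Theorems.RootDecomp1KCubicDescent

/-! ### §5 THE FAMILIES: `VW l` / `V j` (`TangentEmptyAt 5`), `EAW l` / `EA j` (`OddEmptyAt 3`), the REFUSED `W4P` -/

section Families

/-- [datum] the top `Q := Y⁴ − 17` (W4's top). -/
def vQ : ℤ[X] := X ^ 4 - C 17
/-- [datum] the `x¹`-coefficient `G := Y³ + 1` (W4's). -/
def vG : ℤ[X] := X ^ 3 + 1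
/-- [datum] `H_l := 2Y² + 7Y + l`. -/
def vH (l : ℤ) : ℤ[X] := C 2 * X ^ 2 + C 7 * X + C l
/-- [datum] the `x`-coefficients of `VW l`: `c₂ = Q`, `c₁ = G`, `c₀ = H_l`. -/
def vC (l : ℤ) : ℕ → ℤ[X] := fun j => if j = 2 then vQ else if j = 1 then vG else if j = 0 then vH l else 0
/-- [datum] **`VW l := (Y⁴ − 17)·x² + (Y³ + 1)·x + (2Y² + 7Y + l)`** — W4's top AND W4's `x¹`-coefficient. -/
def VW (l : ℤ) : ℤ[X][X] := xPolyP 2 (vC l)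
/-- [datum] `λ_j := −3 + 15j` (`15 = 3·5` freezes the residues mod `3` and mod `5` the certificates read). -/
def vLam (j : ℕ) : ℤ := -3 + 15 * j
/-- [datum] **THE FAMILY `V j := VW (−3 + 15j)`** (CLAIM L2795). -/
def V (j : ℕ) : ℤ[X][X] := VW (vLam j)

/-- `(l : ℤ) : vC l 2 = vQ`. -/
@[simp] theorem vC_two (l : ℤ) : vC l 2 = vQ := by simp [vC]
/-- `(l : ℤ) : vC l 1 = vG`. -/
@[simp] theorem vC_one (l : ℤ) : vC l 1 = vG := by simp [vC]
/-- `(l : ℤ) : vC l 0 = vH l`. -/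
@[simp] theorem vC_zero (l : ℤ) : vC l 0 = vH l := by simp [vC]
/-- `(l : ℤ) {j : ℕ} (hj : 2 < j) : vC l j = 0`. -/
theorem vC_of_gt (l : ℤ) {j : ℕ} (hj : 2 < j) : vC l j = 0 := by
  simp [vC, show j ≠ 2 by omega, show j ≠ 1 by omega, show j ≠ 0 by omega]

/-- `{R : Type*} [CommRing R] [Algebra ℤ R] (y : R) : aeval y vQ = y ^ 4 - 17`. -/
@[simp] theorem aeval_vQ {R : Type*} [CommRing R] [Algebra ℤ R] (y : R) : aeval y vQ = y ^ 4 - 17 := by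
  simp [vQ, map_ofNat]
/-- `{R : Type*} [CommRing R] [Algebra ℤ R] (y : R) : aeval y vG = y ^ 3 + 1`. -/
@[simp] theorem aeval_vG {R : Type*} [CommRing R] [Algebra ℤ R] (y : R) : aeval y vG = y ^ 3 + 1 := by
  simp [vG]
/-- `{R : Type*} [CommRing R] [Algebra ℤ R] (l : ℤ) (y : R) : aeval y (vH l) = 2 * y ^ 2 + 7 * y + (l : R)`. -/
@[simp] theorem aeval_vH {R : Type*} [CommRing R] [Algebra ℤ R] (l : ℤ) (y : R) :
    aeval y (vH l) = 2 * y ^ 2 + 7 * y + (l : R) := by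
  simp [vH, map_ofNat]

/-- `VW l` evaluated: `x²·(y⁴ − 17) + x·(y³ + 1) + (2y² + 7y + l)`. -/
theorem bev_VW (l : ℤ) (x y : ℝ) :
    bev (VW l) x y = x ^ 2 * (y ^ 4 - 17) + x * (y ^ 3 + 1) + (2 * y ^ 2 + 7 * y + l) := by
  rw [VW, bev_xPolyP]
  simp [Finset.sum_range_succ]
  ring

/-- `: vQ.natDegree = 4`. -/
theorem natDegree_vQ : vQ.natDegree = 4 := by rw [vQ]; exact natDegree_X_pow_sub_C
/-- `: vQ.Monic`. -/
theorem monic_vQ : vQ.Monic := by rw [vQ]; exact monic_X_pow_sub_C _ (by norm_num)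
/-- `: vQ ≠ 0`. -/
theorem vQ_ne_zero : vQ ≠ 0 := monic_vQ.ne_zero
/-- `: vG.natDegree = 3`. -/
theorem natDegree_vG : vG.natDegree = 3 := by unfold vG; compute_degree!
/-- `(l : ℤ) : (vH l).natDegree = 2`. -/
theorem natDegree_vH (l : ℤ) : (vH l).natDegree = 2 := by unfold vH; compute_degree!
/-- `: vQ.coeff 4 = 1`. -/
theorem coeff_vQ_four : vQ.coeff 4 = 1 := by rw [← natDegree_vQ]; exact monic_vQ.coeff_natDegree
/-- `: vQ.coeff 0 = -17`. -/
theorem coeff_vQ_zero : vQ.coeff 0 = -17 := by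
  rw [vQ]; simp only [coeff_sub, coeff_X_pow, coeff_C]; norm_num
/-- `: vG.coeff 3 = 1`. -/
theorem coeff_vG_three : vG.coeff 3 = 1 := by
  rw [vG]; simp only [coeff_add, coeff_X_pow, coeff_one]; norm_num
/-- `: vG.coeff 4 = 0`. -/
theorem coeff_vG_four : vG.coeff 4 = 0 := by
  rw [vG]; simp only [coeff_add, coeff_X_pow, coeff_one]; norm_num
/-- `: vG.coeff 0 = 1`. -/
theorem coeff_vG_zero : vG.coeff 0 = 1 := by
  rw [vG]; simp only [coeff_add, coeff_X_pow, coeff_one]; norm_num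
/-- `(l : ℤ) : (vH l).coeff 2 = 2`. -/
theorem coeff_vH_two (l : ℤ) : (vH l).coeff 2 = 2 := by
  rw [vH]; simp only [coeff_add, coeff_C_mul_X_pow, coeff_C_mul_X, coeff_C]; norm_num
/-- `(l : ℤ) : (vH l).coeff 0 = l`. -/
theorem coeff_vH_zero (l : ℤ) : (vH l).coeff 0 = l := by
  rw [vH]; simp only [coeff_add, coeff_C_mul_X_pow, coeff_C_mul_X, coeff_C]; norm_num
/-- `(l : ℤ) (i : ℕ) : xCoeff (VW l) i = vC l i`. -/
theorem xCoeff_VW (l : ℤ) (i : ℕ) : xCoeff (VW l) i = vC l i := by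
  rw [VW, xCoeff_xPolyP]
  split_ifs with h
  · rfl
  · exact (vC_of_gt _ (by omega)).symm

/-- **THE REDUCTION `VW (2 + 5t) ≡ VW 2 (mod 5)` TYPED**: `H_{2+5t}(y) = 2y² + 7y + 2` in `𝔽₅`. -/
theorem aeval_vH_five (t : ℤ) (y : ZMod 5) : aeval y (vH (2 + 5 * t)) = 2 * y ^ 2 + 7 * y + 2 := by
  rw [aeval_vH]
  push_cast
  rw [show (5 : ZMod 5) = 0 from by decide, zero_mul, add_zero]

/-- **AFFINE EMPTINESS mod 5** (25 evaluations, `decide`): `x²(y⁴ − 17) + x(y³ + 1) + (2y² + 7y + 2) ≠ 0` on `𝔽₅²`. -/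
theorem affine_empty_five (t : ℤ) (x y : ZMod 5) :
    ∑ j ∈ Finset.range 3, x ^ j * aeval y (vC (2 + 5 * t) j) ≠ 0 := by
  rw [Finset.sum_range_succ, Finset.sum_range_succ, Finset.sum_range_one, vC_zero, vC_one, vC_two, aeval_vH_five,
    aeval_vG, aeval_vQ]
  revert x y
  decide

/-- **THE TANGENT FORM `X² + XT + 2T²` IS ANISOTROPIC mod 5** (discriminant `−7 ≡ 3`, a non-residue; `decide`). -/
theorem aniso_five (a b : ZMod 5) (h : (1 : ZMod 5) * a ^ 2 + (1 : ZMod 5) * a * b + (2 : ZMod 5) * b ^ 2 = 0) :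
    a = 0 ∧ b = 0 := by
  revert a b
  decide

/-- **`TangentEmptyAt 5 (VW (2 + 5t))`** for EVERY `t` — the W4-shape class, certified by finite arithmetic mod 5. -/
theorem tangentEmptyAt_five_VW (t : ℤ) : TangentEmptyAt 5 (VW (2 + 5 * t)) := by
  refine ⟨vC (2 + 5 * t), 2, rfl, ?_, ?_, ?_, by norm_num, by norm_num, affine_empty_five t, ?_⟩
  · rw [vC_two, natDegree_vQ]
  · rw [vC_one, natDegree_vG]
  · rw [vC_zero, natDegree_vH]
  · intro a b h
    refine aniso_five a b ?_
    simpa only [vC_two, vC_one, vC_zero, Nat.reduceAdd, coeff_vQ_four, coeff_vG_three, coeff_vH_two, Int.cast_one,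
      Int.cast_ofNat] using h

/-- LEVEL-BLIND: `VW (2 + 5t)` has NO rational point with 5-integral abscissa. -/
theorem ratPoint_free_VW (t : ℤ) (x r : ℚ) (hx : ¬ 5 ∣ x.den) : bev (VW (2 + 5 * t)) x r ≠ 0 :=
  ratPoint_free_of_tangentEmptyAt (tangentEmptyAt_five_VW t) x r hx
/-- … hence NO LEVEL POINT AT ALL. -/
theorem no_level_VW (t : ℤ) (N : ℕ) (r : ℚ) : bev (VW (2 + 5 * t)) (partialSum 2 N) r ≠ 0 :=
  no_level_of_tangentEmptyAt (tangentEmptyAt_five_VW t) N r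
/-- `(t : ℤ) : LevelFinite (VW (2 + 5 * t))`. -/
theorem levelFinite_VW (t : ℤ) : LevelFinite (VW (2 + 5 * t)) := levelFinite_of_tangentEmptyAt (tangentEmptyAt_five_VW t)
/-- `(t : ℤ) (m₀ : ℕ) : ThinFibreAt m₀ (VW (2 + 5 * t))`. -/
theorem thinFibreAt_VW (t : ℤ) (m₀ : ℕ) : ThinFibreAt m₀ (VW (2 + 5 * t)) :=
  thinFibreAt_of_tangentEmptyAt (tangentEmptyAt_five_VW t) m₀

/-- `λ_j = 2 + 5·(−1 + 3j)`. -/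
theorem vLam_five (j : ℕ) : vLam j = 2 + 5 * (-1 + 3 * (j : ℤ)) := by rw [vLam]; ring
/-- `λ_j = 3·(−1 + 5j)`. -/
theorem vLam_three (j : ℕ) : vLam j = 3 * (-1 + 5 * (j : ℤ)) := by rw [vLam]; ring
/-- `(j : ℕ) : V j = VW (-3 + 15 * j)` — rfl pin. -/
theorem V_eq (j : ℕ) : V j = VW (-3 + 15 * j) := rfl
/-- **`TangentEmptyAt 5 (V j)` for EVERY `j`.** -/
theorem tangentEmptyAt_five_V (j : ℕ) : TangentEmptyAt 5 (V j) := by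
  rw [V, vLam_five]; exact tangentEmptyAt_five_VW _
/-- **LEVEL-BLIND: `V j` has NO rational point with 5-integral abscissa.** -/
theorem ratPoint_free_V (j : ℕ) (x r : ℚ) (hx : ¬ 5 ∣ x.den) : bev (V j) x r ≠ 0 :=
  ratPoint_free_of_tangentEmptyAt (tangentEmptyAt_five_V j) x r hx
/-- **`∀ j N r, (V j)(s_N, r) ≠ 0` — EVERY LEVEL OF EVERY `V j` IS EMPTY.** -/
theorem no_level_V (j : ℕ) (N : ℕ) (r : ℚ) : bev (V j) (partialSum 2 N) r ≠ 0 :=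
  no_level_of_tangentEmptyAt (tangentEmptyAt_five_V j) N r
/-- **`∀ j, LevelFinite (V j)`**, hypothesis-free. -/
theorem levelFinite_V (j : ℕ) : LevelFinite (V j) := levelFinite_of_tangentEmptyAt (tangentEmptyAt_five_V j)
/-- `(j : ℕ) : BddLevelEmpty (V j)`. -/
theorem bddLevelEmpty_V (j : ℕ) : BddLevelEmpty (V j) := bddLevelEmpty_of_tangentEmptyAt (tangentEmptyAt_five_V j)
/-- **`∀ j m₀, ThinFibreAt m₀ (V j)`** — EVERY quality, hypothesis-free. -/
theorem thinFibreAt_V (j : ℕ) (m₀ : ℕ) : ThinFibreAt m₀ (V j) := thinFibreAt_of_tangentEmptyAt (tangentEmptyAt_five_V j) m₀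

/-- [datum] `E_l := Y⁴ + Y + l` (the general-engine member's `c₀`, of FULL degree). -/
def eaH (l : ℤ) : ℤ[X] := X ^ 4 + X + C l
/-- [datum] the `x`-coefficients of `EAW l`: `c₂ = Q`, `c₁ = G`, `c₀ = E_l`. -/
def eaC (l : ℤ) : ℕ → ℤ[X] := fun j => if j = 2 then vQ else if j = 1 then vG else if j = 0 then eaH l else 0
/-- [datum] **`EAW l := (Y⁴ − 17)·x² + (Y³ + 1)·x + (Y⁴ + Y + l)`** («W4 + Y⁴ + const»). -/
def EAW (l : ℤ) : ℤ[X][X] := xPolyP 2 (eaC l)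
/-- [datum] **`EA j := EAW (2 + 3j)`** (CLAIM L2795; census rows «EA 0», «EA 1»). -/
def EA (j : ℕ) : ℤ[X][X] := EAW (2 + 3 * (j : ℤ))
/-- `(l : ℤ) : eaC l 2 = vQ`. -/
@[simp] theorem eaC_two (l : ℤ) : eaC l 2 = vQ := by simp [eaC]
/-- `(l : ℤ) : eaC l 1 = vG`. -/
@[simp] theorem eaC_one (l : ℤ) : eaC l 1 = vG := by simp [eaC]
/-- `(l : ℤ) : eaC l 0 = eaH l`. -/
@[simp] theorem eaC_zero (l : ℤ) : eaC l 0 = eaH l := by simp [eaC]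
/-- `(l : ℤ) {j : ℕ} (hj : 2 < j) : eaC l j = 0`. -/
theorem eaC_of_gt (l : ℤ) {j : ℕ} (hj : 2 < j) : eaC l j = 0 := by
  simp [eaC, show j ≠ 2 by omega, show j ≠ 1 by omega, show j ≠ 0 by omega]
/-- `{R : Type*} [CommRing R] [Algebra ℤ R] (l : ℤ) (y : R) : aeval y (eaH l) = y ^ 4 + y + (l : R)`. -/
@[simp] theorem aeval_eaH {R : Type*} [CommRing R] [Algebra ℤ R] (l : ℤ) (y : R) :
    aeval y (eaH l) = y ^ 4 + y + (l : R) := by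
  simp [eaH]
/-- `(l : ℤ) : (eaH l).natDegree = 4`. -/
theorem natDegree_eaH (l : ℤ) : (eaH l).natDegree = 4 := by unfold eaH; compute_degree!
/-- `(l : ℤ) : (eaH l).coeff 4 = 1`. -/
theorem coeff_eaH_four (l : ℤ) : (eaH l).coeff 4 = 1 := by
  rw [eaH]; simp only [coeff_add, coeff_X_pow, coeff_X, coeff_C]; norm_num
/-- `(l : ℤ) (i : ℕ) : xCoeff (EAW l) i = eaC l i`. -/
theorem xCoeff_EAW (l : ℤ) (i : ℕ) : xCoeff (EAW l) i = eaC l i := by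
  rw [EAW, xCoeff_xPolyP]
  split_ifs with h
  · rfl
  · exact (eaC_of_gt _ (by omega)).symm
/-- `EAW l` evaluated. -/
theorem bev_EAW (l : ℤ) (x y : ℝ) :
    bev (EAW l) x y = x ^ 2 * (y ^ 4 - 17) + x * (y ^ 3 + 1) + (y ^ 4 + y + l) := by
  rw [EAW, bev_xPolyP]
  simp [Finset.sum_range_succ]
  ring
/-- the reduction `EAW (2 + 3t) ≡ EAW 2 (mod 3)` typed. -/
theorem aeval_eaH_three (t : ℤ) (y : ZMod 3) : aeval y (eaH (2 + 3 * t)) = y ^ 4 + y + 2 := by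
  rw [aeval_eaH]
  push_cast
  rw [show (3 : ZMod 3) = 0 from by decide, zero_mul, add_zero]

/-- **`OddEmptyAt 3 (EAW (2 + 3t))`** (the GENERAL engine's member: affine-pointless mod 3 — 9 evaluations — and the
`Y⁴`-top form `x² + 1` ROOTLESS mod 3; padding degree `n = 4`). -/
theorem oddEmptyAt_three_EAW (t : ℤ) : OddEmptyAt 3 (EAW (2 + 3 * t)) := by
  refine ⟨2, eaC (2 + 3 * t), 4, rfl, ?_, by norm_num, by norm_num, ?_, ?_⟩
  · intro j hj
    interval_cases j
    · rw [eaC_zero, natDegree_eaH]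
    · rw [eaC_one, natDegree_vG]; norm_num
    · rw [eaC_two, natDegree_vQ]
  · intro x y
    rw [Finset.sum_range_succ, Finset.sum_range_succ, Finset.sum_range_one, eaC_zero, eaC_one, eaC_two,
      aeval_eaH_three, aeval_vG, aeval_vQ]
    revert x y
    decide
  · intro x
    rw [Finset.sum_range_succ, Finset.sum_range_succ, Finset.sum_range_one, eaC_zero, eaC_one, eaC_two,
      coeff_eaH_four, coeff_vG_four, coeff_vQ_four, Int.cast_one, Int.cast_zero]
    revert x
    decide
/-- `(j : ℕ) : OddEmptyAt 3 (EA j)`. -/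
theorem oddEmptyAt_three_EA (j : ℕ) : OddEmptyAt 3 (EA j) := oddEmptyAt_three_EAW _
/-- `(j : ℕ) (N : ℕ) (r : ℚ) : bev (EA j) (partialSum 2 N) r ≠ 0`. -/
theorem no_level_EA (j : ℕ) (N : ℕ) (r : ℚ) : bev (EA j) (partialSum 2 N) r ≠ 0 :=
  no_level_of_oddEmptyAt (oddEmptyAt_three_EA j) N r
/-- `(j : ℕ) : LevelFinite (EA j)`. -/
theorem levelFinite_EA (j : ℕ) : LevelFinite (EA j) := levelFinite_of_oddEmptyAt (oddEmptyAt_three_EA j)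
/-- `(j : ℕ) (m₀ : ℕ) : ThinFibreAt m₀ (EA j)`. -/
theorem thinFibreAt_EA (j : ℕ) (m₀ : ℕ) : ThinFibreAt m₀ (EA j) := thinFibreAt_of_oddEmptyAt (oddEmptyAt_three_EA j) m₀

/-- R11: the W4-SHAPE engine does NOT apply to `EAW l` at ANY prime (`deg c₀ = 4` forces the padding `n ≥ 4`, and then
`[Y^{n+2}]c₂ = 0` makes `(1, 0)` isotropic) — the degree hypotheses `h1`/`h0` are load-bearing. -/
theorem not_tangentEmptyAt_EAW (l : ℤ) (ℓ : ℕ) : ¬ TangentEmptyAt ℓ (EAW l) := by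
  rintro ⟨c, n, hP, -, -, h0, hprime, -, -, haniso⟩
  haveI : Fact ℓ.Prime := ⟨hprime⟩
  have hc0 : c 0 = eaH l := by rw [← eaC_zero l, ← xCoeff_EAW l 0, hP, xCoeff_xPolyP, if_pos (Nat.zero_le 2)]
  have hc2 : c 2 = vQ := by rw [← eaC_two l, ← xCoeff_EAW l 2, hP, xCoeff_xPolyP, if_pos le_rfl]
  rw [hc0, natDegree_eaH] at h0
  have hcoeff : (c 2).coeff (n + 2) = 0 := by
    rw [hc2]; exact coeff_eq_zero_of_natDegree_lt (by rw [natDegree_vQ]; omega)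
  have h := (haniso 1 0 (by rw [hcoeff]; simp)).1
  exact one_ne_zero h

/-- R7: the GENERAL engine does NOT apply to `VW l` at ANY prime (`deg c₀ = 2 < 4 = deg c₂`: the `Y`-top form has the
root `x = 0` — the double point `(0, ∞)`); hence the tangent-form engine. -/
theorem not_oddEmptyAt_VW (l : ℤ) (ℓ : ℕ) : ¬ OddEmptyAt ℓ (VW l) :=
  not_oddEmptyAt_of_natDegree_lt 2 (by rw [xCoeff_VW, xCoeff_VW, vC_zero, vC_two, natDegree_vH, natDegree_vQ]; norm_num)
/-- `(j : ℕ) (ℓ : ℕ) : ¬ OddEmptyAt ℓ (V j)`. -/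
theorem not_oddEmptyAt_V (j : ℕ) (ℓ : ℕ) : ¬ OddEmptyAt ℓ (V j) := not_oddEmptyAt_VW _ ℓ

/-- R12: `TangentEmptyAt ℓ` REFUSES `ℓ ∣ lc(c₂)` (anisotropy forces `[Y^{n+2}]c₂ ≢ 0`, so `c₂` is the top, of exact
degree `n + 2`, with leading coefficient prime to `ℓ`). -/
theorem not_dvd_leadingCoeff_of_tangentEmptyAt {ℓ : ℕ} {P : ℤ[X][X]} (h : TangentEmptyAt ℓ P) :
    ¬ (ℓ : ℤ) ∣ (topX P).leadingCoeff := by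
  obtain ⟨c, n, rfl, h2, -, -, hprime, -, -, haniso⟩ := h
  haveI : Fact ℓ.Prime := ⟨hprime⟩
  have h22 : (((c 2).coeff (n + 2) : ℤ) : ZMod ℓ) ≠ 0 := by
    intro h0
    exact one_ne_zero (haniso 1 0 (by rw [h0]; ring)).1
  have hne : (c 2).coeff (n + 2) ≠ 0 := fun h => h22 (by rw [h, Int.cast_zero])
  have hdeg : (c 2).natDegree = n + 2 := le_antisymm h2 (le_natDegree_of_ne_zero hne)
  have hc2 : c 2 ≠ 0 := fun h => hne (by rw [h, coeff_zero])
  rw [topX_xPolyP 2 c hc2, leadingCoeff, hdeg]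
  rwa [Ne, ZMod.intCast_zmod_eq_zero_iff_dvd] at h22

/-- [datum] the `x`-coefficients of the STANDING WITNESS W4: `c₂ = Q`, `c₁ = G`, `c₀ = Y + 2`. -/
def w4C : ℕ → ℤ[X] := fun j => if j = 2 then vQ else if j = 1 then vG else if j = 0 then X + C 2 else 0
/-- [datum] **`W4P := (Y⁴ − 17)·x² + (Y³ + 1)·x + (Y + 2)`** — the record's standing witness W4. -/
def W4P : ℤ[X][X] := xPolyP 2 w4C
/-- W4 evaluated. -/
theorem bev_W4P (x y : ℝ) : bev W4P x y = x ^ 2 * (y ^ 4 - 17) + x * (y ^ 3 + 1) + (y + 2) := by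
  rw [W4P, bev_xPolyP]
  simp [Finset.sum_range_succ, w4C, map_ofNat]
  ring
/-- **W4's RATIONAL POINT `(0, −2)`** (integral abscissa; smooth: `∂P/∂Y(0, −2) = 1`). -/
theorem bev_W4P_point : bev W4P ((0 : ℚ) : ℝ) ((-2 : ℚ) : ℝ) = 0 := by
  rw [bev_W4P]; push_cast; norm_num
/-- **R1: W4 is REFUSED by the general engine at EVERY `ℓ ≠ 1`** (its rational point `(0, −2)`). -/
theorem not_oddEmptyAt_W4P {ℓ : ℕ} (hℓ : ℓ ≠ 1) : ¬ OddEmptyAt ℓ W4P :=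
  not_oddEmptyAt_of_ratPoint 0 (-2) (by simpa using hℓ) bev_W4P_point
/-- **R1: W4 is REFUSED by the W4-shape engine at EVERY `ℓ ≠ 1`.** -/
theorem not_tangentEmptyAt_W4P {ℓ : ℕ} (hℓ : ℓ ≠ 1) : ¬ TangentEmptyAt ℓ W4P :=
  not_tangentEmptyAt_of_ratPoint 0 (-2) (by simpa using hℓ) bev_W4P_point

/-- R4 (haff LOAD-BEARING): `VW (−9) = … + (2Y + 9)(Y − 1)` has the anisotropic tangent form of the family but the
rational point `(0, 1)` — so it is affine-NONEMPTY mod 5 and refused. -/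
theorem bev_VW_neg_nine_point : bev (VW (-9)) ((0 : ℚ) : ℝ) ((1 : ℚ) : ℝ) = 0 := by
  rw [bev_VW]; push_cast; norm_num
/-- `(ℓ : ℕ) (hℓ : ℓ ≠ 1) : ¬ TangentEmptyAt ℓ (VW (-9))`. -/
theorem not_tangentEmptyAt_VW_neg_nine {ℓ : ℕ} (hℓ : ℓ ≠ 1) : ¬ TangentEmptyAt ℓ (VW (-9)) :=
  not_tangentEmptyAt_of_ratPoint 0 1 (by simpa using hℓ) bev_VW_neg_nine_point

/-- [datum] R5 (haniso LOAD-BEARING): `R5P := (Y⁴ − 17)x² + (Y³ + Y + 1)x + (3Y² + 24Y + 414)` — W4 shape,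
affine-EMPTY mod 5, tangent form `X² + XT + 3T²` ISOTROPIC (`(1, 1)`), WITH the rational point `(5, 1/5)`. -/
def r5C : ℕ → ℤ[X] := fun j =>
  if j = 2 then vQ else if j = 1 then X ^ 3 + X + 1 else if j = 0 then C 3 * X ^ 2 + C 24 * X + C 414 else 0
/-- [datum] `R5P := xPolyP 2 r5C`. -/
def R5P : ℤ[X][X] := xPolyP 2 r5C
/-- `R5P` evaluated. -/
theorem bev_R5P (x y : ℝ) :
    bev R5P x y = x ^ 2 * (y ^ 4 - 17) + x * (y ^ 3 + y + 1) + (3 * y ^ 2 + 24 * y + 414) := by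
  rw [R5P, bev_xPolyP]
  simp [Finset.sum_range_succ, r5C, map_ofNat]
  ring
/-- the rational point `(5, 1/5)` of `R5P` (5-integral abscissa, `5 ∣ den r`: chart 2). -/
theorem bev_R5P_point : bev R5P ((5 : ℚ) : ℝ) ((1 / 5 : ℚ) : ℝ) = 0 := by
  rw [bev_R5P]; push_cast; norm_num
/-- `: r5C 2 = vQ`. -/
@[simp] theorem r5C_two : r5C 2 = vQ := by simp [r5C]
/-- `: r5C 1 = X ^ 3 + X + 1`. -/
@[simp] theorem r5C_one : r5C 1 = X ^ 3 + X + 1 := by simp [r5C]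
/-- `: r5C 0 = C 3 * X ^ 2 + C 24 * X + C 414`. -/
@[simp] theorem r5C_zero : r5C 0 = C 3 * X ^ 2 + C 24 * X + C 414 := by simp [r5C]
/-- EVERY hypothesis of the W4-shape engine EXCEPT anisotropy holds for `R5P` (padding `n = 2`): the presentation, the
three degree bounds, the prime, affine emptiness mod 5 — and the tangent form's coefficients are `(1, 1, 3)`. -/
theorem r5_shape : R5P = xPolyP 2 r5C ∧ (r5C 2).natDegree ≤ 2 + 2 ∧ (r5C 1).natDegree ≤ 2 + 1 ∧ (r5C 0).natDegree ≤ 2 ∧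
    (r5C 2).coeff (2 + 2) = 1 ∧ (r5C 1).coeff (2 + 1) = 1 ∧ (r5C 0).coeff 2 = 3 := by
  refine ⟨rfl, ?_, ?_, ?_, ?_, ?_, ?_⟩
  · rw [r5C_two, natDegree_vQ]
  · rw [r5C_one]; compute_degree
  · rw [r5C_zero]; compute_degree
  · rw [r5C_two]; exact coeff_vQ_four
  · rw [r5C_one]; simp only [coeff_add, coeff_X_pow, coeff_X, coeff_one]; norm_num
  · rw [r5C_zero]; simp only [coeff_add, coeff_C_mul_X_pow, coeff_C_mul_X, coeff_C]; norm_num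
/-- `R5P` is affine-EMPTY mod 5 … -/
theorem affine_empty_five_r5 (x y : ZMod 5) : ∑ j ∈ Finset.range 3, x ^ j * aeval y (r5C j) ≠ 0 := by
  rw [Finset.sum_range_succ, Finset.sum_range_succ, Finset.sum_range_one, r5C_zero, r5C_one, r5C_two]
  simp only [aeval_vQ, map_add, map_mul, map_pow, aeval_X, aeval_C, map_one, algebraMap_int_eq, Int.coe_castRingHom]
  push_cast
  revert x y
  decide
/-- … its tangent form `X² + XT + 3T²` is ISOTROPIC mod 5 (`(1, 1)`) … -/
theorem not_aniso_r5 : ¬ ∀ a b : ZMod 5, (1 : ZMod 5) * a ^ 2 + (1 : ZMod 5) * a * b + (3 : ZMod 5) * b ^ 2 = 0 →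
    a = 0 ∧ b = 0 := by
  intro h; exact absurd (h 1 1 (by decide)).1 (by decide)
/-- … and it is REFUSED: `¬ TangentEmptyAt ℓ R5P` for every `ℓ ≠ 1` (the point `(5, 1/5)`). -/
theorem not_tangentEmptyAt_R5P {ℓ : ℕ} (hℓ : ℓ ≠ 1) : ¬ TangentEmptyAt ℓ R5P :=
  not_tangentEmptyAt_of_ratPoint 5 (1 / 5) (by simpa using hℓ) bev_R5P_point

/-- R14 (instrument agreement, LIVENESS-v16): `¬ TangentEmptyAt 3 (V 0)` — the affine `𝔽₃`-point `(0, 0)`. -/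
theorem not_tangentEmptyAt_three_V0 : ¬ TangentEmptyAt 3 (V 0) :=
  not_tangentEmptyAt_of_root_zero (0 : ZMod 3) (by rw [V, xCoeff_VW, vC_zero, aeval_vH, vLam]; push_cast; decide)
/-- R14: `¬ OddEmptyAt 5 (EA 0)` — the affine `𝔽₅`-point `(0, 2)` (`2⁴ + 2 + 2 = 20`). -/
theorem not_oddEmptyAt_five_EA0 : ¬ OddEmptyAt 5 (EA 0) :=
  not_oddEmptyAt_of_root_zero (2 : ZMod 5) (by rw [EA, xCoeff_EAW, eaC_zero, aeval_eaH]; push_cast; decide)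
/-- R9 (NO CONVERSE): node 20's `CJ 0` (`ThinFibreAt 2` by 3-descent) is NOT `OddEmptyAt 3` — the affine `𝔽₃`-point
`(0, 1)` of `c₀ = −(Y² + 5)`. -/
theorem not_oddEmptyAt_three_CJ0 : ¬ OddEmptyAt 3 (CJ 0) :=
  not_oddEmptyAt_of_root_zero (1 : ZMod 3) (by rw [xCoeff_CJ, cbC_zero, map_neg, aeval_cbH]; push_cast; decide)
/-- … nor `TangentEmptyAt 3` (same affine point). -/
theorem not_tangentEmptyAt_three_CJ0 : ¬ TangentEmptyAt 3 (CJ 0) :=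
  not_tangentEmptyAt_of_root_zero (1 : ZMod 3) (by rw [xCoeff_CJ, cbC_zero, map_neg, aeval_cbH]; push_cast; decide)

/-- **EVERY LEVEL SET OF `V j` IS EMPTY** (the honest reading of `LevelFinite (V j)` here). -/
theorem levelSet_V (j : ℕ) (C : ℝ) : LevelSet (V j) C = ∅ :=
  Set.eq_empty_of_forall_notMem fun N ⟨r, _, h, _⟩ => no_level_V j N r h
/-- the LEVEL-BLIND core specialised to INTEGRAL abscissae: `V j` has no point `(x, r)` with `x ∈ ℤ`, `r ∈ ℚ`. -/
theorem intPoint_free_V (j : ℕ) (x : ℤ) (r : ℚ) : bev (V j) (x : ℚ) r ≠ 0 :=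
  ratPoint_free_V j x r (by simp)

end Families

end Summit.Schanuel.Schanuel.Theorems.RootDecomp1KOddEmpty

end
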